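import Literature.AnabelianGeometry.SemiGraphs.ArithBranchGeometricPart
import Literature.AnabelianGeometry.SemiGraphs.TemperedVerticialNotEdgeLike
import HarnessLib

/-!
# [SemiAnbd] §5, p. 65: `Π^temp_{𝔊,b} ≠ Π^temp_{𝔊,v}` for the produced decomposition data (menu item hγ)

For the arithmetic decomposition data PRODUCED from a tempered chart
(`ProfiniteSemiGraph.decompositionDataOfChart R ι`, abc-iut-w4-d053, LEVEL A: `Π^temp_{𝔊,v}` is the
commensurator of `ι(Π_v-representative)`, `Π^temp_{𝔊,b} = Π^temp_{𝔊,v} ∩ C(ι Π_b-representative)`), the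
branch group of a branch `b` abutting to `v` is a PROPER subgroup of the vertex group:
`Π^temp_{𝔊,b} ≠ Π^temp_{𝔊,v}`. This is the T54 coordinator's menu item **hγ**
(`∀ b v, D.abut b = some v → D.brGp b ≠ D.vertGp v`, "edge group of infinite index in the vertex group"),
here DISCHARGED at the produced data modulo the one named input `CompactInVerticial` ([SemiAnbd] Thm 3.7 (iii),
carried by abc-iut-L3-t11) exactly as in abc-iut-w4-d040's `arithBrGp_inf_range_eq_map`.

Proof (three landed inputs): abc-iut-w4-d040's `commensurator_inf_eq_of_edgeLike_le_verticial`
(`C(Π_b) ∩ Π_v = Π_b` for an edge-like `Π_b ≤ Π_v` verticial), the unconditional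
`not_mem_edgeLikeSubgroups_of_mem_verticialSubgroups` (a verticial subgroup is never edge-like, Thm 3.7), and
abc-iut-w4-d053's `arithBrGp_ne_arithVertGp_of` (the arithmetic inequality from a geometric witness
`x ∈ Π_v ∖ C(Π_b)`): if every element of `Π_v` commensurated `Π_b` then `Π_v = C(Π_b) ∩ Π_v = Π_b` would be
both verticial and edge-like.

No side is taken on [IUTchIII] Cor 3.12; typed ≠ proved. [cite: MochizukiSemiAnbd2006, §5, p. 65; Thm 3.7, pp. 40–41]
-/

namespace Literature.AnabelianGeometry.SemiGraphs

namespace ProfiniteSemiGraph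

open scoped Pointwise

universe u u'

variable {𝒢 : ProfiniteSemiGraph.{u}}

/-- **Geometric witness for hγ.** For chart representatives `R` (a verticial `Π_v ∋` an edge-like `Π_b` for
every branch `b` abutting to `v`), some element of `Π_v` does NOT commensurate `Π_b`: otherwise
`Π_v ≤ C(Π_b)`, so `Π_v = C(Π_b) ∩ Π_v = Π_b` (abc-iut-w4-d040's `commensurator_inf_eq_of_edgeLike_le_verticial`,
modulo `CompactInVerticial`) would be verticial AND edge-like, contradicting Thm 3.7
(`not_mem_edgeLikeSubgroups_of_mem_verticialSubgroups`). [cite: MochizukiSemiAnbd2006, Thm 3.7 (iii), pp. 40–41] -/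
theorem exists_mem_Hv_not_mem_commensurator_Hb (hCV : CompactInVerticial.{u})
    (h𝒢 : 𝒢.Thm37Hypotheses) (hG : 𝒢.graph.IsGraph) {c : TemperedPiChart 𝒢} (R : ChartRepresentatives c)
    {b : 𝒢.graph.Branch} {v : 𝒢.graph.Vertex} (hbv : 𝒢.graph.abuts b = some v) :
    ∃ x ∈ R.Hv v, x ∉ Subgroup.Commensurable.commensurator (R.Hb b) := by
  by_contra h
  push Not at h
  have hle : R.Hv v ≤ Subgroup.Commensurable.commensurator (R.Hb b) := fun x hx => h x hx
  have heq := commensurator_inf_eq_of_edgeLike_le_verticial hCV h𝒢 hG c (R.Hb_mem b) (R.Hv_mem v)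
    (R.Hb_le b v hbv)
  rw [inf_eq_right.mpr hle] at heq
  have hL : R.Hv v ∈ edgeLikeSubgroups c (𝒢.graph.edgeOf b) := heq ▸ R.Hb_mem b
  exact not_mem_edgeLikeSubgroups_of_mem_verticialSubgroups h𝒢 c (R.Hv_mem v) hL

variable {c : TemperedPiChart 𝒢} {Gtp : Type u'} [Group Gtp]

/-- **`Π^temp_{𝔊,b} ≠ Π^temp_{𝔊,v}`** for the produced arithmetic vertex / branch groups along an injective
`ι : π₁^temp(𝒢) ↪ Π^temp_𝔊` (Prop 5.2 (iv)), for every branch `b` abutting to `v` — modulo `CompactInVerticial`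
(Thm 3.7 (iii)). [cite: MochizukiSemiAnbd2006, §5, p. 65] -/
theorem arithBrGp_ne_arithVertGp (hCV : CompactInVerticial.{u}) (h𝒢 : 𝒢.Thm37Hypotheses)
    (hG : 𝒢.graph.IsGraph) (R : ChartRepresentatives c) {ι : c.G →* Gtp} (hι : Function.Injective ι)
    {b : 𝒢.graph.Branch} {v : 𝒢.graph.Vertex} (hbv : 𝒢.graph.abuts b = some v) :
    arithBrGp R ι b ≠ arithVertGp R ι v :=
  arithBrGp_ne_arithVertGp_of R hι hbv (exists_mem_Hv_not_mem_commensurator_Hb hCV h𝒢 hG R hbv)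

/-- **Menu item hγ at the produced data** (T54 coordinator abc-iut-w4-d085's binder, verbatim shape
`∀ b v, D.abut b = some v → D.brGp b ≠ D.vertGp v`, for `D := decompositionDataOfChart R ι`): the branch group of
a branch is never the whole vertex group it abuts to — modulo `CompactInVerticial` (Thm 3.7 (iii)).
[cite: MochizukiSemiAnbd2006, §5, p. 65] -/
theorem decompositionDataOfChart_brGp_ne_vertGp (hCV : CompactInVerticial.{u}) (h𝒢 : 𝒢.Thm37Hypotheses)
    (hG : 𝒢.graph.IsGraph) (R : ChartRepresentatives c) (ι : c.G →* Gtp) (hι : Function.Injective ι) :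
    ∀ b v, (decompositionDataOfChart R ι).abut b = some v →
      (decompositionDataOfChart R ι).brGp b ≠ (decompositionDataOfChart R ι).vertGp v := by
  intro b v hbv
  rw [decompositionDataOfChart_abut] at hbv
  rw [decompositionDataOfChart_brGp, decompositionDataOfChart_vertGp]
  exact arithBrGp_ne_arithVertGp hCV h𝒢 hG R hι hbv

end ProfiniteSemiGraph

end Literature.AnabelianGeometry.SemiGraphs
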